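import Summits.BirchSwinnertonDyer.BirchSwinnertonDyer.Theorems.AdditiveBranchIMCGordTwoTwistedWanDefs
import Summits.BirchSwinnertonDyer.BirchSwinnertonDyer.Theorems.AdditiveBranchIMCGordTwoTwistedDyadicClass
import HarnessLib

/-!
# Route `AdditiveBranchIMC`, cruxes `GordTwoRankZeroOffCaseOne` (19357) / `GordTwoRankOne` (19358): the VOCABULARY of DOOR D — «the
# DYADIC prime `ℓ₀ = 2` as the `K`-RAMIFIED twisted Wan prime» — under the Theorems import fence (definitions + three one-line lemmas;
# nothing asserted, nothing booked)

Drafted by the pen (planner bsd-addord-plan g48, memo `planner/g2_3f_enlarge/e22/`, tree draft `Cruxes/GordTwoRankOne/TwistedWanTwoDefsDraft.lean`),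
landed by the LEAD (cruxlead-19357 g19; director-bsd (770)) as the `ℓ₀ = 2` companion of `AdditiveBranchIMCGordTwoTwistedWanDefs.lean` (p-numbers there)
and of `AdditiveBranchIMCGordTwoTwistedLooseDefs.lean` (p816632), so that (i) the door-D kernel (frame / flat chain / socket / Gross–Zagier identity /
logarithm transport / joint lower half, re-keyed from the odd-`ℓ₀` files to the typed readings R2₂ / R3₂ / R4₂ of wi-101331 / wi-101332 / wi-101333) is
stated over NAMED predicates, and (ii) the registered residual stubs of 19357 / 19358 can be reshaped by ONE more negated hypothesis
`¬ TwistedWanRowR0Two W p` / `¬ TwistedWanRoadRowTwo W p` and closed BY NAME, exactly as bricks E2 / E3′ / doors A2, C.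
LEAD's two edits to the pen's draft (director (770) «bytes = the draft modulo the LEAD's frame naming»): (a) `TwistedWanPrimeTwo` is the LOOSE
dyadic twisted Wan prime — Skinner–Urban's ramification clause `p ∤ v_2(j)` is NOT part of it (lesson of door C, p816632: FIELD 1 never uses the clause;
it enters only design D2's FIELD 3, where it is supplied as the separate disjunction «`p ∤ v_2(j)` OR a multiplicative `r ≠ p` with `p ∤ v_r(Δ_min)`»,
which the rank-zero row `TwistedWanRowR0Two` carries and the rank-one row does not need at all); (b) the statement-only `def`s
`FieldOneTwistedTwo` / `FieldOneTwistedR0Two` / `EngineTwistedTwo` of the draft are NOT landed: the two supplies are already THEOREMS with their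
conclusions spelled out (p818590 `fieldOneTwisted_two_of_fh`, p818465 `fieldOneTwistedR0_two_of_bfh`), and no engine is needed on the door-D road
(`w(X) = +1` / `−1` is automatic there, LeadReport27 §5).

THE DICTIONARY `ℓ₀ ↦ 2` (pen memo e21 §1–§3c; census e20: +476 r₁ / +426 r₀ rows `N < 10⁴` whose ONLY potentially-multiplicative additive
twist-type prime is `2`). `E` (globally minimal `W`) ADDITIVE at `2` of quadratic-twist type and potentially multiplicative there: `W₁ := E^{(t)}`
MULTIPLICATIVE at `2` for one `t ∈ {−1, 2, −2}` (prime discriminant `t* = disc ℚ(√t) = 4t ∈ {−4, 8, −8}` replaces `ℓ₀* = (−1)^{(ℓ₀−1)/2}ℓ₀`).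
Road field `K` imaginary quadratic with `2` RAMIFIED, `d_K = 4·t·n`, `n ≡ 1 (mod 4)` — THE LEAD's SPELLING (p814401
`TwistedWanRoad.quadraticTwist_discr_nonsplit_at_two_of_dyadicClass` / `baseChange_nonsplit_two_of_dyadicClass`), adopted here so that the class
theorem plugs in with no conversion: the NON-SPLIT genus class is `n ≡ 1 (mod 8)` if `W₁` is non-split at `2`, `n ≡ 5 (mod 8)` if split
(`E^{(d_K)} ≅ W₁^{(n)}`, an unramified twist at `2`; `E/K_𝔮 = (W₁ ⊗ ν)/K_𝔮` with `ν = χ_{4t} ∘ N_{K/ℚ}` the everywhere-unramified genus character,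
`ν(𝔮) = χ_n(2)`). At `ℓ₀ = 2` the depletion constant of the `f_E`-keyed displays is `1 + 2⁻¹ = 3/2`, a `p`-adic unit for every `p ≥ 5`:
door D has NO unit cut and NO class cut (both split types of `W₁` at `2` own a genus class).

* `TwistedWanPrimeTwo W p t` — `p ≠ 2`, `t ∈ {−1, 2, −2}`, `E` additive at `2`, `W₁ = E^{(t)}` multiplicative at `2` (NO Skinner–Urban clause);
* `NonsplitClassAtTwo W t K` — `∃ n, d_K = 4·t·n ∧ n % 8 = (5 if W₁ split at 2, else 1)`;
* `TameRoadFieldTwistedTwo W p t K` — the door-D road field (every ODD prime of `N_E` split; `p` split);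
* `TwistedWanRoadRowTwo` (rank-one key, crux 19358) / `TwistedWanRowR0Two` (rank-zero key, crux 19357: + `p ∤ ∏ c_ℓ` + Skinner–Urban's prime
  «`p ∤ v_2(j)` OR a multiplicative `r ≠ p` with `p ∤ v_r(Δ_min)`») and the projection;
* lemmas: `two_dvd_discr_of_nonsplitClassAtTwo`, `baseChange_nonsplit_two_of_tameRoadFieldTwistedTwo` (= p814401 read through the predicates:
  the binder «`E/K` non-split multiplicative above `2`» of R2₂/R3₂/R4₂), `twistedWanRoadRowTwo_of_twistedWanRowR0Two`.

HONEST FRAMING: definitions and three unfolding lemmas; no named fact is minted (no cite tag on a predicate), nothing is booked; 19357 / 19358 stay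
OPEN; door D is director-bsd (769)(B) «GO at the printed price sheet». BSD is proved for no curve.
References: [SkinnerUrban2014] Thm. 3.6.4; [Gross2004] §2; [CastellaLiuWan2022] §5.2; [Hsieh2014] Thm. B; [LiuZhangZhang2018] §1.5;
[CaiShuTian2014] Thm 1.1, Prop 3.12; [HoffsteinLuo1997] §1; [Rohrlich1993Compositio] Prop. 2 (iii); [AtkinLi1978] §3; [SilvermanAEC2009] X.5 Cor. 5.4.
presearch: n/a (route vocabulary; the print behind each statement is cited in `AdditiveBranchIMCGordTwoTwistedWanDefs.lean` and the typer rows).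
-/

set_option autoImplicit false
set_option linter.dupNamespace false

noncomputable section

open scoped Classical

open NumberField IsDedekindDomain IsDedekindDomain.HeightOneSpectrum Rat.HeightOneSpectrum
open WeierstrassCurve Literature.NumberTheory.EllipticCurves
  Literature.NumberTheory.EllipticCurves.ModularForms
  Literature.NumberTheory.EllipticCurves.Rank1Residual
open Summit.BirchSwinnertonDyer.Rank1Residual
open Summit.BirchSwinnertonDyer.Rank1Residual.Additive
open Summit.BirchSwinnertonDyer.BirchSwinnertonDyer.Theorems

namespace Summit.BirchSwinnertonDyer.BirchSwinnertonDyer.Theorems.TwistedWanRoad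

/-- THE (LOOSE) DYADIC TWISTED WAN PRIME (e21 sketch, spelling aligned with p814401): `p` odd; `E` (globally minimal `W`) ADDITIVE at `2` of
quadratic-twist type AND potentially multiplicative — `W₁ := E^{(t)}` multiplicative at `2` for the twist `t ∈ {−1, 2, −2}`. NO Skinner–Urban
clause `p ∤ v_2(j)` (it is not used by FIELD 1; the rank-zero row carries Skinner–Urban's prime separately, see `TwistedWanRowR0Two`). The
`ℓ₀ = 2` companion of `TwistedWanPrimeLoose` (whose `ℓ ≠ 2` excludes exactly these rows). [predicate; nothing asserted] -/
def TwistedWanPrimeTwo (W : WeierstrassCurve ℚ) [W.IsElliptic] (p : ℕ) (t : ℤ) : Prop :=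
  p ≠ 2 ∧ (t = -1 ∨ t = 2 ∨ t = -2) ∧ W.HasAdditiveReductionAt ((primesEquiv (R := ℤ)).symm ⟨2, Nat.prime_two⟩) ∧
    (W.quadraticTwist (t : ℚ)).HasMultiplicativeReductionAtPrime 2

/-- THE GENUS CLASS AT `2` (p814401's hypotheses `hn` / `hclass` bundled): `d_K = 4·t·n` with `n ≡ 5 (mod 8)` if `W₁ = E^{(t)}` is SPLIT
multiplicative at `2` and `n ≡ 1 (mod 8)` if it is non-split (`Int.emod`: a negative `n` is read in `{1, 5}` too; either way `n ≡ 1 (mod 4)`, so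
`4t ∥ d_K`, `2` is RAMIFIED in `K`, `ν = χ_{4t}∘N` is unramified and `ν(𝔮) = χ_n(2)`) — the class `a_2(W₁)·χ_n(2) = −1` for which
`E^{(d_K)} ≅ W₁^{(n)}` is non-split at `2` and `E/K_𝔮` is NON-SPLIT multiplicative. The `ℓ₀ = 2` companion of `NonsplitClassAt`.
[predicate; nothing asserted] -/
def NonsplitClassAtTwo (W : WeierstrassCurve ℚ) [W.IsElliptic] (t : ℤ) (K : Type) [Field K] [NumberField K] : Prop :=
  ∃ n : ℤ, NumberField.discr K = 4 * t * n ∧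
    n % 8 = (if (W.quadraticTwist (t : ℚ)).HasSplitMultiplicativeReductionAtPrime 2 then 5 else 1)

/-- THE DOOR-D ROAD FIELD: `K` imaginary quadratic, `d_K < −4`, the dyadic twisted Wan prime in its non-split genus class (`2` RAMIFIED in `K`),
every ODD prime of `N_E` split in `K` (among them `p`, additive for `E`: `SatisfiesHeegnerHypothesis p K` = `p` split). The `ℓ₀ = 2` companion of
`TameRoadFieldTwisted` (whose clause «`2` split if `2 ∤ N_E`» is void here: `4 ∣ N_E`). [predicate; nothing asserted] -/
def TameRoadFieldTwistedTwo (W : WeierstrassCurve ℚ) [W.IsElliptic] [W.IsGloballyMinimal] (p : ℕ) (t : ℤ)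
    (K : Type) [Field K] [NumberField K] : Prop :=
  IsImaginaryQuadratic K ∧ NumberField.discr K < -4 ∧ TwistedWanPrimeTwo W p t ∧ NonsplitClassAtTwo W t K ∧
    (∀ r : ℕ, r.Prime → r ∣ W.conductorNorm ℤ → r ≠ 2 → ((Ideal.span {(r : ℤ)}).primesOver (𝓞 K)).ncard = 2) ∧
    SatisfiesHeegnerHypothesis p K

/-- THE DOOR-D SUB-ROW OF THE RANK-ONE LINE (crux 19358): `p ≥ 5`, `ρ̄_{E,p}` onto, every additive prime `≠ p` of quadratic-twist type (the two
clauses of `TwistedWanRoadRow` verbatim), and a DYADIC twisted Wan prime. NO unit cut (`p ∤ 2 + 1` is automatic for `p ≥ 5`), NO class cut.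
[predicate; nothing asserted] -/
def TwistedWanRoadRowTwo (W : WeierstrassCurve ℚ) [W.IsElliptic] [W.IsGloballyMinimal] (p : ℕ) [Fact p.Prime] : Prop :=
  5 ≤ p ∧ Surj W p ∧
    (∀ r : Nat.Primes, (r : ℕ) = 2 → W.HasAdditiveReductionAt ((primesEquiv (R := ℤ)).symm r) →
      ∃ t : ℤ, (t = -1 ∨ t = 2 ∨ t = -2) ∧
        ¬ (W.quadraticTwist (t : ℚ)).HasAdditiveReductionAt ((primesEquiv (R := ℤ)).symm r)) ∧
    (∀ r : Nat.Primes, (r : ℕ) ≠ 2 → W.HasAdditiveReductionAt ((primesEquiv (R := ℤ)).symm r) →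
      ¬ (W.quadraticTwist (((-1 : ℤ) ^ ((r : ℕ) / 2) * r : ℤ) : ℚ)).HasAdditiveReductionAt
        ((primesEquiv (R := ℤ)).symm r)) ∧
    (∃ t : ℤ, TwistedWanPrimeTwo W p t)

/-- THE DOOR-D SUB-ROW OF THE RANK-ZERO LINE (crux 19357 `three_field_road`): the rank-one clauses, the r₀ Tamagawa clause `p ∤ ∏ c_ℓ`
(as `TwistedWanRowR0`), and Skinner–Urban's ramified prime for design D2's FIELD 3 — EITHER at `2` itself (`p ∤ v_2(j)`, `j(E) = j(W₁)`,
`v_2(j) = −v_2(Δ_min(W₁))`) OR at a multiplicative prime `r ≠ p` of `E` with `p ∤ v_r(Δ_min)` (the loose disjunction of door C, p817204).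
[predicate; nothing asserted] -/
def TwistedWanRowR0Two (W : WeierstrassCurve ℚ) [W.IsElliptic] [W.IsGloballyMinimal] (p : ℕ) [Fact p.Prime] : Prop :=
  5 ≤ p ∧ Surj W p ∧
    (∀ r : Nat.Primes, (r : ℕ) = 2 → W.HasAdditiveReductionAt ((primesEquiv (R := ℤ)).symm r) →
      ∃ t : ℤ, (t = -1 ∨ t = 2 ∨ t = -2) ∧
        ¬ (W.quadraticTwist (t : ℚ)).HasAdditiveReductionAt ((primesEquiv (R := ℤ)).symm r)) ∧
    (∀ r : Nat.Primes, (r : ℕ) ≠ 2 → W.HasAdditiveReductionAt ((primesEquiv (R := ℤ)).symm r) →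
      ¬ (W.quadraticTwist (((-1 : ℤ) ^ ((r : ℕ) / 2) * r : ℤ) : ℚ)).HasAdditiveReductionAt
        ((primesEquiv (R := ℤ)).symm r)) ∧
    (∃ t : ℤ, TwistedWanPrimeTwo W p t) ∧ ¬ p ∣ W.tamagawaProduct ∧
    (¬ (p : ℤ) ∣ padicValRat 2 W.j ∨
      ∃ (r : ℕ) (_ : Fact r.Prime), r ≠ p ∧ W.HasMultiplicativeReductionAtPrime r ∧ ¬ p ∣ padicValInt r W.minimalDiscriminantInt)

/-- The rank-zero door-D sub-row is the rank-one sub-row with the Tamagawa clause and Skinner–Urban's prime (projection). [folklore] -/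
theorem twistedWanRoadRowTwo_of_twistedWanRowR0Two (W : WeierstrassCurve ℚ) [W.IsElliptic] [W.IsGloballyMinimal] (p : ℕ)
    [Fact p.Prime] (h : TwistedWanRowR0Two W p) : TwistedWanRoadRowTwo W p ∧ ¬ p ∣ W.tamagawaProduct ∧
    (¬ (p : ℤ) ∣ padicValRat 2 W.j ∨
      ∃ (r : ℕ) (_ : Fact r.Prime), r ≠ p ∧ W.HasMultiplicativeReductionAtPrime r ∧ ¬ p ∣ padicValInt r W.minimalDiscriminantInt) :=
  ⟨⟨h.1, h.2.1, h.2.2.1, h.2.2.2.1, h.2.2.2.2.1⟩, h.2.2.2.2.2.1, h.2.2.2.2.2.2⟩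

/-- In the genus class at `2`, `2 ∣ d_K` (`2` is ramified in `K`): the binder `(2 : ℤ) ∣ NumberField.discr K` of the typer rows R2₂/R3₂/R4₂.
[folklore] -/
theorem two_dvd_discr_of_nonsplitClassAtTwo (W : WeierstrassCurve ℚ) [W.IsElliptic] (t : ℤ) (K : Type) [Field K] [NumberField K]
    (h : NonsplitClassAtTwo W t K) : (2 : ℤ) ∣ NumberField.discr K := by
  obtain ⟨n, hn, -⟩ := h
  exact ⟨2 * t * n, by rw [hn]; ring⟩

/-- **On a door-D road field `E/K` is NON-SPLIT multiplicative at the prime above `2`** — p814401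
(`baseChange_nonsplit_two_of_dyadicClass`) read through the named predicates: the binder «`∀ v ∋ 2, (W.baseChange K) multiplicative ∧ ¬ split
at v`» of the typer rows R2₂/R3₂/R4₂. [cite: SilvermanAEC2009, VII.5 Prop. 5.1 (b), Prop. 5.4 (b), X.5 Cor. 5.4] -/
theorem baseChange_nonsplit_two_of_tameRoadFieldTwistedTwo (W : WeierstrassCurve ℚ) [W.IsElliptic] [W.IsGloballyMinimal] (p : ℕ)
    (t : ℤ) (K : Type) [Field K] [NumberField K] (h : TameRoadFieldTwistedTwo W p t K) :
    ∀ v : HeightOneSpectrum (𝓞 K), ((2 : ℕ) : 𝓞 K) ∈ v.asIdeal →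
      (W.baseChange K).HasMultiplicativeReductionAt v ∧ ¬ (W.baseChange K).HasSplitMultiplicativeReductionAt v := by
  obtain ⟨hK, -, ⟨-, ht, -, hmult⟩, ⟨n, hn, hclass⟩, -, -⟩ := h
  exact baseChange_nonsplit_two_of_dyadicClass W ht hmult K hK hn hclass

end Summit.BirchSwinnertonDyer.BirchSwinnertonDyer.Theorems.TwistedWanRoad

end
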